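import Literature.NumberTheory.Automorphic.ShimuraCurveRibetTakahashi
import Literature.NumberTheory.Automorphic.ShimuraCurveIdealCountBridge
import Literature.NumberTheory.Automorphic.ShimuraCurveIdealCountAsymptotics
import Literature.NumberTheory.Automorphic.ShimuraCurveOrbitIdealCount
import Literature.NumberTheory.Automorphic.ShimuraCurveVolumeSplitCase
import Literature.NumberTheory.Automorphic.ShimuraCurveFiniteVolume
import Literature.NumberTheory.Automorphic.ShimuraCurveGroupDiscrete
import Literature.NumberTheory.Automorphic.ShimuraCurveCovolume
import Literature.NumberTheory.Automorphic.HypFundamentalDomainVolume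
import Literature.NumberTheory.Automorphic.FuchsianDirichletDomain
import Literature.NumberTheory.Automorphic.MatrixConeLatticeCount
import Literature.NumberTheory.Automorphic.QuaternionAlgebraAdelicRamificationProofs
import HarnessLib

/-!
# The volume of the Shimura curve `X₀^D(M)`: proof of `ShimuraCurveData.volume_fd_eq`

Topic `NumberTheory/Automorphic`; theorems only (no definition, no named fact, no instance).
**Discharge** of the named fact `Literature.NumberTheory.Automorphic.ShimuraCurveData.volume_fd_eq`
of `ShimuraCurveRibetTakahashi.lean`: for every Shimura curve datum `X : ShimuraCurveData D M` with
`M ≥ 1`, `vol(X.fd) = (π/3) φ(D) ψ(M)` (Shimizu; Vignéras IV §3.A; Eichler).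

* `D = 1`: `ShimuraCurveData.volume_fd_eq_of_discr_one` (`Γ₀(M)`, in the tree).
* `D = 0` cannot occur (every finite place would ramify; `not_discr_zero`).
* `D > 1` (`volume_fd_eq_of_one_lt`), Eichler's lattice-point computation of the covolume of
  `Γ = ι(O¹)`: take a Dirichlet pair `F₀ ⊆ F₁` for `Γ` (`exists_dirichletDomain_pair`, using
  cocompactness `exists_forall_exists_smul_mem_closedBall`); the number of `α ∈ O` with
  `0 < nrd α ≤ T` and `ι(α) i ∈ F_j` is `~ (π/2) vol(F) T² / (DM)` (`tendsto_card_cone_div_sq` for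
  the lattice `ι(O)` of covolume `DM`, `abs_det_entries_eq`), and is squeezed against twice the
  number of principal left ideals `Oα`, `0 < nrd α ≤ T` (`card_coneElems_le`,
  `two_mul_card_leftIdeals_le`: the stabilisers are `O¹ ∋ ±1`); that number is `∑_{n ≤ T} a(n)`
  (`card_leftIdeals_eq_sum_card_integralIdeals`: involution and Eichler's theorem that the
  invertible right ideals are principal with positive generators), and
  `∑_{n ≤ N} a(n) ~ (π²/12)(φ(D)/D)(ψ(M)/M) N²` (`tendsto_sum_card_integralIdeals_div_sq`);
  comparing the two asymptotics gives `vol(F) = (π/3) φ(D) ψ(M)`, and `vol(X.fd) = vol(F₁)`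
  (`volume_eq_volume_fd`).

## References

* H. Shimizu, *On discontinuous groups operating on the product of the upper half planes*,
  Ann. of Math. 77 (1963) (the volume of the fundamental domain of the unit group of an order)
  [Shimizu1963].
* M.-F. Vignéras, *Arithmétique des algèbres de quaternions*, LNM 800 (1980), Ch. IV §1–§3,
  Ch. V §2 [VignerasLNM800].
* M. Eichler, *Lectures on modular correspondences*, TIFR Lectures on Mathematics 9 (1955–56).
-/

open Filter MeasureTheory NumberField IsDedekindDomain
open scoped Topology Real MatrixGroups ComplexConjugate Pointwise
open Literature.NumberTheory.EllipticCurves.ModularForms (gamma0Index)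

namespace Literature.NumberTheory.Automorphic

/-! ### The cone sections are bounded -/

/-- The cone section `{x : 0 < det x ≤ T, x i ∈ S}` (entry coordinates) is bounded when `S` lies in
a box `|Re z| ≤ R`, `0 < δ ≤ Im z ≤ R` (scale `isBounded_cone_one` by `√T`). [folklore] -/
theorem isBounded_cone {S : Set UpperHalfPlane} {R δ : ℝ} (hδ : 0 < δ)
    (hbd : ∀ z ∈ S, |z.re| ≤ R ∧ δ ≤ z.im ∧ z.im ≤ R) (T : ℝ) :
    Bornology.IsBounded {x : Fin 2 × Fin 2 → ℝ | ∃ g : GL (Fin 2) ℝ, (∀ i j, g i j = x (i, j)) ∧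
      0 < g.det.val ∧ g.det.val ≤ T ∧ g • UpperHalfPlane.I ∈ S} := by
  by_cases hT : 0 < T
  · have hsT : 0 < Real.sqrt T := Real.sqrt_pos.mpr hT
    have hsub : {x : Fin 2 × Fin 2 → ℝ | ∃ g : GL (Fin 2) ℝ, (∀ i j, g i j = x (i, j)) ∧
        0 < g.det.val ∧ g.det.val ≤ T ∧ g • UpperHalfPlane.I ∈ S} ⊆
        Real.sqrt T • {x : Fin 2 × Fin 2 → ℝ | ∃ g : GL (Fin 2) ℝ, (∀ i j, g i j = x (i, j)) ∧
          0 < g.det.val ∧ g.det.val ≤ 1 ∧ g • UpperHalfPlane.I ∈ S} := by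
      intro x hx
      obtain ⟨hpos, hle, hmem⟩ := (exists_gl_entries_iff' x (fun t => t ≤ T) S).mp hx
      refine ⟨(Real.sqrt T)⁻¹ • x, ?_, smul_inv_smul₀ hsT.ne' x⟩
      rw [Set.mem_setOf_eq, exists_gl_entries_iff' _ (fun t => t ≤ 1) S,
        (rows_smul (Real.sqrt T)⁻¹ x).1, (rows_smul (Real.sqrt T)⁻¹ x).2]
      set r₁ : ℂ := ⟨x (0, 0), x (0, 1)⟩
      set r₂ : ℂ := ⟨x (1, 0), x (1, 1)⟩
      set t : ℝ := (Real.sqrt T)⁻¹ with ht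
      have ht0 : (t : ℂ) ≠ 0 := by rw [ht]; exact_mod_cast (inv_pos.mpr hsT).ne'
      have him : (conj ((t : ℂ) * r₁) * ((t : ℂ) * r₂)).im = t ^ 2 * (conj r₁ * r₂).im := by
        rw [map_mul, Complex.conj_ofReal,
          show (t : ℂ) * conj r₁ * ((t : ℂ) * r₂) = ((t ^ 2 : ℝ) : ℂ) * (conj r₁ * r₂) by push_cast; ring,
          Complex.im_ofReal_mul]
      have hquot : conj ((t : ℂ) * r₁ / ((t : ℂ) * r₂)) = conj (r₁ / r₂) := by
        rw [mul_div_mul_left _ _ ht0]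
      rw [him, hquot]
      have ht2 : t ^ 2 = T⁻¹ := by rw [ht, inv_pow, Real.sq_sqrt hT.le]
      refine ⟨mul_pos (pow_pos (inv_pos.mpr hsT) 2) hpos, ?_, hmem⟩
      rw [ht2]
      calc T⁻¹ * (conj r₁ * r₂).im ≤ T⁻¹ * T := mul_le_mul_of_nonneg_left hle (inv_nonneg.mpr hT.le)
        _ = 1 := inv_mul_cancel₀ hT.ne'
    exact ((isBounded_cone_one hδ hbd).smul₀ (Real.sqrt T)).subset hsub
  · refine Bornology.isBounded_empty.subset fun x hx => ?_
    obtain ⟨g, -, hpos, hle, -⟩ := hx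
    exact hT (hpos.trans_le hle)

namespace ShimuraCurveData

variable {D M : ℕ} (X : ShimuraCurveData D M)

/-! ### Lattice points in the cone are the elements of `O` counted by `nrd` and `ι(α) i` -/

/-- **The entry map `α ↦ (ι(α)_{kl})` is a bijection** from
`{α ∈ O : 0 < nrd α ≤ T, ι(α) i ∈ S}` onto the lattice points of `ℤ v = ι(O)` in the cone section
`{x : 0 < det x ≤ T, x i ∈ S}`, for a `ℤ`-basis `bb` of `O` with entry vectors `v`
(`det ι(α) = nrd α`). [folklore] -/
theorem bijOn_entries_coneElems (bb : Module.Basis (Fin 2 × Fin 2) ℤ X.O)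
    (v : Module.Basis (Fin 2 × Fin 2) ℝ (Fin 2 × Fin 2 → ℝ))
    (hv : ∀ i k, v i k = X.ι (bb i : X.B) k.1 k.2) (S : Set UpperHalfPlane) (T : ℝ) :
    Set.BijOn (fun α : X.B => fun k : Fin 2 × Fin 2 => X.ι α k.1 k.2)
      {α : X.B | α ∈ X.O ∧ 0 < reducedNorm ℚ X.B α ∧ ((reducedNorm ℚ X.B α : ℚ) : ℝ) ≤ T ∧
        ∃ g : GL (Fin 2) ℝ, (g : Matrix (Fin 2) (Fin 2) ℝ) = X.ι α ∧ g • UpperHalfPlane.I ∈ S}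
      ({x : Fin 2 × Fin 2 → ℝ | ∃ g : GL (Fin 2) ℝ, (∀ i j, g i j = x (i, j)) ∧
          0 < g.det.val ∧ g.det.val ≤ T ∧ g • UpperHalfPlane.I ∈ S} ∩
        (Submodule.span ℤ (Set.range v) : Set (Fin 2 × Fin 2 → ℝ))) := by
  classical
  -- the entry map as a `ℤ`-linear map
  set φ : X.B →ₗ[ℤ] (Fin 2 × Fin 2 → ℝ) :=
    ((LinearEquiv.curry ℝ ℝ (Fin 2) (Fin 2)).symm.toLinearMap.restrictScalars ℤ).comp
      (X.ι.toLinearMap.restrictScalars ℤ) with hφdef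
  have hφ : ∀ α : X.B, φ α = fun k : Fin 2 × Fin 2 => X.ι α k.1 k.2 := fun α => rfl
  have hinj : Function.Injective (fun α : X.B => fun k : Fin 2 × Fin 2 => X.ι α k.1 k.2) := by
    intro a b h
    apply X.ι_injective
    ext i j
    exact congrFun h (i, j)
  -- `ℤ v = φ(O)`
  have hspan : (Submodule.span ℤ (Set.range v) : Set (Fin 2 × Fin 2 → ℝ)) = φ '' (X.O : Set X.B) := by
    have hrange : Set.range v = φ '' Set.range (fun i => (bb i : X.B)) := by
      rw [← Set.range_comp]
      refine congrArg Set.range (funext fun i => ?_)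
      rw [Function.comp_apply, hφ]
      funext k
      exact hv i k
    have hO : Submodule.span ℤ (Set.range fun i => (bb i : X.B)) = X.O := by
      have h : Set.range (fun i => (bb i : X.B)) = X.O.subtype '' Set.range bb := by
        rw [← Set.range_comp]; rfl
      rw [h, Submodule.span_image, bb.span_eq, Submodule.map_top, Submodule.range_subtype]
    rw [hrange, Submodule.span_image, hO, Submodule.map_coe]
  -- the cone condition in terms of `α`
  have hcond : ∀ α : X.B, (∃ g : GL (Fin 2) ℝ, (∀ i j, g i j = (fun k : Fin 2 × Fin 2 => X.ι α k.1 k.2) (i, j)) ∧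
      0 < g.det.val ∧ g.det.val ≤ T ∧ g • UpperHalfPlane.I ∈ S) ↔
      (0 < reducedNorm ℚ X.B α ∧ ((reducedNorm ℚ X.B α : ℚ) : ℝ) ≤ T ∧
        ∃ g : GL (Fin 2) ℝ, (g : Matrix (Fin 2) (Fin 2) ℝ) = X.ι α ∧ g • UpperHalfPlane.I ∈ S) := by
    intro α
    constructor
    · rintro ⟨g, hg, hpos, hle, hS⟩
      have hgm : (g : Matrix (Fin 2) (Fin 2) ℝ) = X.ι α := Matrix.ext fun i j => hg i j
      have hdet : g.det.val = ((reducedNorm ℚ X.B α : ℚ) : ℝ) := by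
        rw [Matrix.GeneralLinearGroup.val_det_apply, hgm, X.det_ι]
      refine ⟨?_, hdet ▸ hle, g, hgm, hS⟩
      have : (0 : ℝ) < ((reducedNorm ℚ X.B α : ℚ) : ℝ) := hdet ▸ hpos
      exact_mod_cast this
    · rintro ⟨hpos, hle, g, hgm, hS⟩
      have hdet : g.det.val = ((reducedNorm ℚ X.B α : ℚ) : ℝ) := by
        rw [Matrix.GeneralLinearGroup.val_det_apply, hgm, X.det_ι]
      refine ⟨g, fun i j => by rw [hgm], ?_, hdet ▸ hle, hS⟩
      rw [hdet]; exact_mod_cast hpos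
  refine ⟨fun α hα => ⟨(hcond α).mpr hα.2, ?_⟩, hinj.injOn, fun x hx => ?_⟩
  · rw [hspan]
    exact ⟨α, hα.1, (hφ α)⟩
  · obtain ⟨hxC, hxL⟩ := hx
    rw [hspan] at hxL
    obtain ⟨α, hαO, rfl⟩ := hxL
    rw [hφ] at hxC ⊢
    exact ⟨α, ⟨hαO, (hcond α).mp hxC⟩, rfl⟩

/-! ### `D = 0` does not occur -/

/-- There is no Shimura curve datum with `D = 0` (every finite place of `ℚ` would ramify in `B`,
but only finitely many do). [folklore] -/
theorem not_discr_zero (X : ShimuraCurveData 0 M) : False := by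
  have hall : ramifiedPlaces ℚ X.B = Set.univ := Set.eq_univ_of_forall fun v =>
    (X.mem_ramifiedPlaces_iff v).mpr (by rw [Nat.cast_zero]; exact Submodule.zero_mem _)
  have hfin := ramifiedPlaces_finite_holds ℚ X.B
  rw [hall] at hfin
  haveI : Infinite Nat.Primes := Set.infinite_coe_iff.mpr Nat.infinite_setOf_prime
  haveI : Infinite (HeightOneSpectrum (𝓞 ℚ)) :=
    Infinite.of_injective _ (Rat.HeightOneSpectrum.primesEquiv (R := 𝓞 ℚ)).symm.injective
  exact Set.infinite_univ hfin

/-! ### The main computation (`D > 1`) -/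

/-- **`vol(X₀^D(M)) = (π/3) φ(D) ψ(M)` for `D > 1`** (Eichler's lattice-point computation of the
covolume of `O¹`, see the module docstring; Shimizu, Vignéras IV §3).
[cite: Shimizu1963] [cite: VignerasLNM800, Ch. IV §1, §3.A and Ch. V §2] -/
theorem volume_fd_eq_of_one_lt (hD : 1 < D) (hM : 0 < M) :
    volume X.fd = ENNReal.ofReal (Real.pi / 3 * ((Nat.totient D * gamma0Index M : ℕ) : ℝ)) := by
  classical
  have hdiv : ∀ x : X.B, x ≠ 0 → IsUnit x := fun x hx => X.isUnit_of_ne_zero hD x hx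
  -- a Dirichlet pair for `Γ`
  obtain ⟨ρ, hρ⟩ := X.exists_forall_exists_smul_mem_closedBall hD
  obtain ⟨F₀, F₁, h01, hF₀open, hF₁closed, ⟨p, R₀, hF₁sub⟩, hcov, huniq, hdiff, hfr₀, hfr₁, hFD⟩ :=
    exists_dirichletDomain_pair X.Gamma_le_range_toGL X.isDiscreteSubgroup_Gamma
      ⟨Metric.closedBall UpperHalfPlane.I ρ, isCompact_closedBall _ _, hρ⟩
  obtain ⟨R, δ, hδ, hbd₁⟩ := exists_bounds_of_subset_closedBall hF₁sub
  have hbd₀ : ∀ z ∈ F₀, |z.re| ≤ R ∧ δ ≤ z.im ∧ z.im ≤ R := fun z hz => hbd₁ z (h01 hz)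
  -- volumes
  have hvol₁ : volume F₁ < ⊤ :=
    lt_of_le_of_lt (measure_mono hF₁sub) (isCompact_closedBall p R₀).measure_lt_top
  have hvol₀₁ : volume F₀ = volume F₁ := by
    refine le_antisymm (measure_mono h01) ?_
    calc volume F₁ = volume (F₀ ∪ F₁ \ F₀) := by
          rw [Set.union_sdiff_self, Set.union_eq_self_of_subset_left h01]
      _ ≤ volume F₀ + volume (F₁ \ F₀) := measure_union_le _ _
      _ = volume F₀ := by rw [hdiff, add_zero]
  set μ : ℝ := (volume F₁).toReal with hμ
  -- a `ℤ`-basis of `O` and the lattice `ι(O)` in entry coordinates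
  obtain ⟨n, b, b', hb'⟩ := X.exists_basis_real hdiv
  have hn : n = 4 := by
    have h := Module.finrank_eq_card_basis b'
    rw [Module.finrank_matrix, Fintype.card_fin, Fintype.card_fin, Module.finrank_self] at h
    omega
  subst hn
  set e4 : Fin 4 ≃ Fin 2 × Fin 2 := (finProdFinEquiv (m := 2) (n := 2)).symm with he4
  set bb : Module.Basis (Fin 2 × Fin 2) ℤ X.O := b.reindex e4 with hbb
  set v : Module.Basis (Fin 2 × Fin 2) ℝ (Fin 2 × Fin 2 → ℝ) :=
    (b'.reindex e4).map (LinearEquiv.curry ℝ ℝ (Fin 2) (Fin 2)).symm with hvdef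
  have hv : ∀ i k, v i k = X.ι (bb i : X.B) k.1 k.2 := by
    intro i k
    have h1 : v i = (LinearEquiv.curry ℝ ℝ (Fin 2) (Fin 2)).symm (b' (e4.symm i)) := by
      rw [hvdef, Module.Basis.map_apply, Module.Basis.reindex_apply]
      rfl
    have h2 : (bb i : X.B) = b (e4.symm i) := by rw [hbb, Module.Basis.reindex_apply]
    rw [h1, h2, ← hb']
    rfl
  have hdet : |(Matrix.of fun i k => v i k).det| = ((D * M : ℕ) : ℝ) := by
    have h := X.abs_det_entries_eq hdiv bb
    convert h using 4
    ext i k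
    exact hv i k
  have hDM : (0 : ℝ) < ((D * M : ℕ) : ℝ) := by
    have : 0 < D * M := Nat.mul_pos (by omega) hM
    exact_mod_cast this
  -- the counting functions
  set CE : Set UpperHalfPlane → ℝ → Set X.B := fun S T => {α : X.B | α ∈ X.O ∧
    0 < reducedNorm ℚ X.B α ∧ ((reducedNorm ℚ X.B α : ℚ) : ℝ) ≤ T ∧
      ∃ g : GL (Fin 2) ℝ, (g : Matrix (Fin 2) (Fin 2) ℝ) = X.ι α ∧ g • UpperHalfPlane.I ∈ S} with hCE
  set LI : ℝ → Set (Set X.B) := fun T => {I : Set X.B | ∃ α ∈ X.O, 0 < reducedNorm ℚ X.B α ∧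
    ((reducedNorm ℚ X.B α : ℚ) : ℝ) ≤ T ∧ I = (fun o : X.B => o * α) '' (X.O : Set X.B)} with hLI
  -- lattice-point asymptotics for `F₀` and `F₁`
  have hlim : ∀ S : Set UpperHalfPlane, MeasurableSet S → volume (frontier S) = 0 →
      (∀ z ∈ S, |z.re| ≤ R ∧ δ ≤ z.im ∧ z.im ≤ R) →
      Tendsto (fun T : ℝ => (Nat.card (CE S T) : ℝ) / T ^ 2) atTop
        (𝓝 (π / 2 * (volume S).toReal / ((D * M : ℕ) : ℝ))) := by
    intro S hS hfrS hbdS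
    have h := tendsto_card_cone_div_sq v hS hfrS hδ hbdS
    rw [hdet] at h
    refine h.congr fun T => ?_
    rw [Nat.card_congr ((X.bijOn_entries_coneElems bb v hv S T).equiv _)]
  have hA := hlim F₀ hF₀open.measurableSet hfr₀ hbd₀
  have hC := hlim F₁ hF₁closed.measurableSet hfr₁ hbd₁
  rw [hvol₀₁] at hA
  -- finiteness of the cone counts and Eichler's orbit/ideal inequalities
  have hfinCE : ∀ T, (CE F₁ T).Finite := by
    intro T
    have hbij := X.bijOn_entries_coneElems bb v hv F₁ T
    refine Set.Finite.of_finite_image ?_ hbij.injOn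
    rw [hbij.image_eq]
    exact ZSpan.setFinite_inter v (isBounded_cone hδ hbd₁ T)
  have hI3 : ∀ T, (LI T).Finite ∧ 2 * Nat.card (LI T) ≤ Nat.card (CE F₁ T) := fun T =>
    X.two_mul_card_leftIdeals_le F₁ T hcov (hfinCE T)
  have hI3' : ∀ T, Nat.card (CE F₀ T) ≤ 2 * Nat.card (LI T) := fun T =>
    X.card_coneElems_le F₀ T huniq (hI3 T).1
  -- squeeze: `2 #LI(T) / T² → (π/2) μ / (DM)`
  have hsq : Tendsto (fun T : ℝ => (2 * Nat.card (LI T) : ℝ) / T ^ 2) atTop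
      (𝓝 (π / 2 * μ / ((D * M : ℕ) : ℝ))) := by
    refine tendsto_of_tendsto_of_tendsto_of_le_of_le hA hC (fun T => ?_) (fun T => ?_)
    · have h : ((Nat.card (CE F₀ T) : ℕ) : ℝ) ≤ ((2 * Nat.card (LI T) : ℕ) : ℝ) :=
        Nat.cast_le.mpr (hI3' T)
      rw [Nat.cast_mul, Nat.cast_ofNat] at h
      exact div_le_div_of_nonneg_right h (sq_nonneg T)
    · have h : ((2 * Nat.card (LI T) : ℕ) : ℝ) ≤ ((Nat.card (CE F₁ T) : ℕ) : ℝ) :=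
        Nat.cast_le.mpr (hI3 T).2
      rw [Nat.cast_mul, Nat.cast_ofNat] at h
      exact div_le_div_of_nonneg_right h (sq_nonneg T)
  have hnat : Tendsto (fun N : ℕ => (2 * Nat.card (LI N) : ℝ) / (N : ℝ) ^ 2) atTop
      (𝓝 (π / 2 * μ / ((D * M : ℕ) : ℝ))) := hsq.comp tendsto_natCast_atTop_atTop
  -- the ideal-count asymptotics
  set Cst : ℝ := (Nat.totient D : ℝ) / D * ((gamma0Index M : ℝ) / M) with hCst
  have hG := X.tendsto_sum_card_integralIdeals_div_sq hD hM
  have hnat' : Tendsto (fun N : ℕ => (2 * Nat.card (LI N) : ℝ) / (N : ℝ) ^ 2) atTop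
      (𝓝 (2 * (π ^ 2 / 12 * Cst))) := by
    refine (hG.const_mul 2).congr fun N => ?_
    rw [hLI]
    simp only
    rw [X.card_leftIdeals_eq_sum_card_integralIdeals hD hM N]
    push_cast
    ring
  -- compare the two limits
  have hEq : π / 2 * μ / ((D * M : ℕ) : ℝ) = 2 * (π ^ 2 / 12 * Cst) := tendsto_nhds_unique hnat hnat'
  have hD0 : (D : ℝ) ≠ 0 := by exact_mod_cast (show D ≠ 0 by omega)
  have hM0 : (M : ℝ) ≠ 0 := by exact_mod_cast hM.ne'
  have hμval : μ = Real.pi / 3 * ((Nat.totient D * gamma0Index M : ℕ) : ℝ) := by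
    have h : μ = 2 * (π ^ 2 / 12 * Cst) * ((D * M : ℕ) : ℝ) * 2 / π := by
      field_simp at hEq ⊢
      linarith [hEq, Real.pi_pos]
    rw [h, hCst]
    push_cast
    field_simp
    ring
  -- conclude
  rw [← X.volume_eq_volume_fd hFD, ← ENNReal.ofReal_toReal hvol₁.ne, ← hμ, hμval]

/-! ### The discharge -/

/-- **Discharge of `ShimuraCurveData.volume_fd_eq`**: `vol(X.fd) = (π/3) φ(D) ψ(M)` for every Shimura
curve datum with `M ≥ 1` (`D = 1`: `volume_fd_eq_of_discr_one`; `D > 1`: `volume_fd_eq_of_one_lt`;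
`D = 0` impossible). [cite: Shimizu1963] [cite: VignerasLNM800, Ch. IV §3.A] -/
theorem volume_fd_eq_holds : volume_fd_eq := by
  unfold volume_fd_eq
  intro D M X hM
  rcases Nat.lt_trichotomy D 1 with hD | rfl | hD
  · have hD0 : D = 0 := by omega
    subst hD0
    exact (X.not_discr_zero).elim
  · exact X.volume_fd_eq_of_discr_one hM
  · exact X.volume_fd_eq_of_one_lt hD hM

end ShimuraCurveData

end Literature.NumberTheory.Automorphic
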